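import Mathlib
import HarnessLib
import Summits.ResolutionOfSingularities.ResolutionOfSingularities.Theorems.WildQuotientsWildQuotientResolutionS1aSymTail

/-!
# S1a — THE LINE-ARRANGEMENT CLASS `L_d`, ring level: the tail `∏ ℓᵢ`, the norms `N(ℓ_m)`, the PRODUCT COVER `(x₀^{…}, (∏_{m≠i} N(ℓ_m))^{…})` and its `hrad`

[OURS · L1 W4.5c · lead-1 g15; R3 `lines_killsIn_two` (RULING R-F15l); lead-1 FINDING (STATUS 2026-08-29 ~08:50Z): the designated chart of a member must avoid the
other components, so the root move uses the (d+1)-element PRODUCT COVER `c₀ = x₀^{…}`, `c_i = (∏_{m ≠ i} N(ℓ_m))^{…}` (the chart `D(c_i)` holds exactly the component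
of `ℓᵢ`, and every `ℓ_m`, `m ≠ i`, is a unit there); pattern ✓`…S1aSymCover`] — NOT statements of the manuscript; counted 0; AI-level work, weaker than expert review.
Crux stmt-ResolutionOfSingularities-17941 `CyclicQuotientFourfolds`, line `s1a-logminvertex` v13 (`stub_reachLowerInFX`).

Datum: `σx₀ = x₀`, `σx₁ = x₁ + x₀`, `σx₂ = x₂ + x₀`, lines `ℓ_m = a_m x₁ + b_m x₂` (`m : Fin d`), `c_m = a_m + b_m` (`σℓ_m = ℓ_m + c_m x₀`), norms
`N_m = ∏_{j : ZMod p} (e⁻¹ℓ_m + j·e⁻¹(c_m x₀))`, centre `e⁻¹(x₀, x₁, x₂)` with weights `(d+1, 1, 1)`.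
* `lines_L_mem` (`e⁻¹ℓ_m ∈ 𝒥₁`), `lines_tail_mem` (`e⁻¹(∏ ℓ_m) ∈ 𝒥_d`), `lines_factor_tau`, `lines_norm_fixed`, `lines_norm_mem` (`N_m ∈ 𝒥_p`), `lines_P_mem`
  (`∏_{m≠i} N_m ∈ 𝒥_{(d−1)p}`), `lines_cover_P_mem` / `lines_cover_P_fixed` (cover elements `(∏_{m≠i} N_m)^{(d+1)·d·D}` of degree `(D(d−1))·((d+1)dp)`),
  `lines_norm_T` (`N_m·T^p = ∏_j (ℓ̂_m + j·ĉ_m·u₀′s^d)`, `ℓ̂_m = e⁻¹ℓ_m·T = â_m u₁′ + b̂_m u₂′`);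
* ★ `lines_hrad` — for `d ≥ 2` pairwise non-proportional lines: `u₀′, u₁′, u₂′ ∈ √(c₀, c_1, …, c_d)` (prime avoidance: every prime over the cover contains two
  distinct `ℓ̂_m`, hence `u₁′, u₂′`).
-/

set_option linter.dupNamespace false

noncomputable section

open Literature.AlgebraicGeometry.Resolution
open scoped LaurentPolynomial
open MvPolynomial
open Summit.ResolutionOfSingularities.ResolutionOfSingularities.Theorems.WildQuotientResolution.S1
open Summit.ResolutionOfSingularities.ResolutionOfSingularities.Theorems.WildQuotientResolution.S1.CoarseChart
open Summit.ResolutionOfSingularities.ResolutionOfSingularities.Theorems.WildQuotientResolution.S1.BlowupCharts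

namespace Summit.ResolutionOfSingularities.ResolutionOfSingularities.Theorems.WildQuotientResolution.S1.KillCert.Lines

variable {k : Type} [Field k] {A : Type} [CommRing A]
  (σ : MvPolynomial (Fin 4) k ≃+* MvPolynomial (Fin 4) k) (hC : ∀ c : k, σ (C c) = C c)
  (h0 : σ (X 0) = X 0) (h1 : σ (X 1) = X 1 + X 0) (h2 : σ (X 2) = X 2 + X 0) {d : ℕ} (a b : Fin d → k)
  (e : A ≃+* MvPolynomial (Fin 4) k) (τ : A ≃+* A) (hact : ∀ x : A, τ x = e.symm (σ (e x))) {p : ℕ}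

/-! ## The lines and the tail -/

/-- `e⁻¹ℓ_m ∈ 𝒥₁` for a linear form `ℓ = a x₁ + b x₂`. -/
theorem lines_L_mem (a' b' : k) : e.symm (C a' * X 1 + C b' * X 2) ∈ (weightedFiltration (e.symm ∘ ![X 0, X 1, X 2] : Fin 3 → A) ![d + 1, 1, 1]).ideal 1 := by
  rw [map_add, map_mul, map_mul]
  exact add_mem (Ideal.mul_mem_left _ _ (mem_weightedFiltration_ideal (e.symm ∘ ![X 0, X 1, X 2] : Fin 3 → A) ![d + 1, 1, 1] 1))
    (Ideal.mul_mem_left _ _ (mem_weightedFiltration_ideal (e.symm ∘ ![X 0, X 1, X 2] : Fin 3 → A) ![d + 1, 1, 1] 2))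

/-- The tail `e⁻¹(∏ ℓ_m) ∈ 𝒥_d`. -/
theorem lines_tail_mem : e.symm (∏ m : Fin d, (C (a m) * X 1 + C (b m) * X 2)) ∈ (weightedFiltration (e.symm ∘ ![X 0, X 1, X 2] : Fin 3 → A) ![d + 1, 1, 1]).ideal d := by
  rw [map_prod]
  have h := Ideal.prod_mem_prod (s := (Finset.univ : Finset (Fin d))) (fun m _ => lines_L_mem (d := d) e (a m) (b m))
  rw [Finset.prod_const, Finset.card_univ, Fintype.card_fin] at h
  have hle := Veronese.idealFiltration_pow_le (weightedFiltration (e.symm ∘ ![X 0, X 1, X 2] : Fin 3 → A) ![d + 1, 1, 1]) 1 d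
  rw [one_mul] at hle
  exact hle h

/-- `subst(∏ ℓ_m) = x_none^d · ∏ ℓ_m(x′)` (the lines are homogeneous of degree 1). -/
theorem lines_subst_tail : cobordantAlgebra.subst k (![d + 1, 1, 1, 0] : Fin 4 → ℕ) (∏ m : Fin d, (C (a m) * X 1 + C (b m) * X 2) : MvPolynomial (Fin 4) k) =
    X none ^ d * ∏ m : Fin d, (C (a m) * X (some 1) + C (b m) * X (some 2) : MvPolynomial (Option (Fin 4)) k) := by
  rw [map_prod]
  have hm : ∀ m : Fin d, cobordantAlgebra.subst k (![d + 1, 1, 1, 0] : Fin 4 → ℕ) (C (a m) * X 1 + C (b m) * X 2 : MvPolynomial (Fin 4) k) =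
      X none * (C (a m) * X (some 1) + C (b m) * X (some 2)) := by
    intro m
    rw [map_add, map_mul, map_mul, cobordantAlgebra.subst, MvPolynomial.eval₂Hom_C, MvPolynomial.eval₂Hom_C, MvPolynomial.eval₂Hom_X', MvPolynomial.eval₂Hom_X']
    change C (a m) * (X none ^ 1 * X (some 1)) + C (b m) * (X none ^ 1 * X (some 2)) = _
    ring
  simp_rw [hm]
  rw [Finset.prod_mul_distrib, Finset.prod_const, Finset.card_univ, Fintype.card_fin]

/-! ## The norms -/

include hact hC h0 h1 h2 in
/-- `τ` shifts the factors of the norm: `τ(e⁻¹ℓ_m + j·e⁻¹(c_m x₀)) = e⁻¹ℓ_m + (j+1)·e⁻¹(c_m x₀)`. -/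
theorem lines_factor_tau [NeZero p] [CharP A p] (hp1 : p ≠ 1) (m : Fin d) (j : ZMod p) :
    τ (e.symm (C (a m) * X 1 + C (b m) * X 2) + (j.val : A) * e.symm (C (a m + b m) * X 0)) =
      e.symm (C (a m) * X 1 + C (b m) * X 2) + ((j + 1).val : A) * e.symm (C (a m + b m) * X 0) := by
  have hval : ((j + 1).val : A) = (j.val : A) + 1 := by
    rw [ZMod.val_add, ZMod.val_one'' hp1, ← CharP.cast_eq_mod A p (j.val + 1), Nat.cast_add, Nat.cast_one]
  rw [map_add, map_mul, map_natCast, A1.act_symm σ e τ hact, A1.act_symm σ e τ hact, hval]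
  simp only [map_add, map_mul, hC, h0, h1, h2]
  ring

include hact hC h0 h1 h2 in
/-- **The norm `N_m` is `τ`-fixed.** -/
theorem lines_norm_fixed [NeZero p] [CharP A p] (hp1 : p ≠ 1) (m : Fin d) :
    τ (∏ j : ZMod p, (e.symm (C (a m) * X 1 + C (b m) * X 2) + (j.val : A) * e.symm (C (a m + b m) * X 0))) =
      ∏ j : ZMod p, (e.symm (C (a m) * X 1 + C (b m) * X 2) + (j.val : A) * e.symm (C (a m + b m) * X 0)) := by
  rw [map_prod]
  simp_rw [lines_factor_tau σ hC h0 h1 h2 a b e τ hact hp1]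
  exact Fintype.prod_equiv (Equiv.addRight 1) _ _ fun j => rfl

/-- `N_m ∈ 𝒥_p`. -/
theorem lines_norm_mem [NeZero p] (m : Fin d) :
    (∏ j : ZMod p, (e.symm (C (a m) * X 1 + C (b m) * X 2) + (j.val : A) * e.symm (C (a m + b m) * X 0))) ∈
      (weightedFiltration (e.symm ∘ ![X 0, X 1, X 2] : Fin 3 → A) ![d + 1, 1, 1]).ideal p := by
  have hX0 : e.symm (C (a m + b m) * X 0) ∈ (weightedFiltration (e.symm ∘ ![X 0, X 1, X 2] : Fin 3 → A) ![d + 1, 1, 1]).ideal 1 := by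
    rw [map_mul]
    exact Ideal.mul_mem_left _ _ ((weightedFiltration _ _).antitone (show 1 ≤ (![d + 1, 1, 1] : Fin 3 → ℕ) 0 by change 1 ≤ d + 1; omega)
      (mem_weightedFiltration_ideal (e.symm ∘ ![X 0, X 1, X 2] : Fin 3 → A) ![d + 1, 1, 1] 0))
  have hfac : ∀ j : ZMod p, e.symm (C (a m) * X 1 + C (b m) * X 2) + (j.val : A) * e.symm (C (a m + b m) * X 0) ∈
      (weightedFiltration (e.symm ∘ ![X 0, X 1, X 2] : Fin 3 → A) ![d + 1, 1, 1]).ideal 1 :=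
    fun j => add_mem (lines_L_mem (d := d) e (a m) (b m)) (Ideal.mul_mem_left _ _ hX0)
  have := Ideal.prod_mem_prod (s := (Finset.univ : Finset (ZMod p))) (fun j _ => hfac j)
  rw [Finset.prod_const, Finset.card_univ, ZMod.card] at this
  have hle := Veronese.idealFiltration_pow_le (weightedFiltration (e.symm ∘ ![X 0, X 1, X 2] : Fin 3 → A) ![d + 1, 1, 1]) 1 p
  rw [one_mul] at hle
  exact hle this

/-- `∏_{m ≠ i} N_m ∈ 𝒥_{(d−1)p}`. -/
theorem lines_P_mem [NeZero p] (i : Fin d) :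
    (∏ m ∈ Finset.univ.erase i, ∏ j : ZMod p, (e.symm (C (a m) * X 1 + C (b m) * X 2) + (j.val : A) * e.symm (C (a m + b m) * X 0))) ∈
      (weightedFiltration (e.symm ∘ ![X 0, X 1, X 2] : Fin 3 → A) ![d + 1, 1, 1]).ideal ((d - 1) * p) := by
  have := Ideal.prod_mem_prod (s := Finset.univ.erase i) (fun m _ => lines_norm_mem (d := d) a b e (p := p) m)
  rw [Finset.prod_const, Finset.card_erase_of_mem (Finset.mem_univ i), Finset.card_univ, Fintype.card_fin] at this
  have hle := Veronese.idealFiltration_pow_le (weightedFiltration (e.symm ∘ ![X 0, X 1, X 2] : Fin 3 → A) ![d + 1, 1, 1]) p (d - 1)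
  rw [Nat.mul_comm p] at hle
  exact hle this

/-- **Cover element `i`**: `(∏_{m≠i} N_m)^{(d+1)dD} ∈ 𝒥_{(D(d−1))·((d+1)dp)}`. -/
theorem lines_cover_P_mem [NeZero p] (D : ℕ) (i : Fin d) :
    (∏ m ∈ Finset.univ.erase i, ∏ j : ZMod p, (e.symm (C (a m) * X 1 + C (b m) * X 2) + (j.val : A) * e.symm (C (a m + b m) * X 0))) ^ ((d + 1) * d * D) ∈
      (weightedFiltration (e.symm ∘ ![X 0, X 1, X 2] : Fin 3 → A) ![d + 1, 1, 1]).ideal ((D * (d - 1)) * ((d + 1) * d * p)) := by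
  have h := Ideal.pow_mem_pow (lines_P_mem (d := d) a b e (p := p) i) ((d + 1) * d * D)
  have hle := Veronese.idealFiltration_pow_le (weightedFiltration (e.symm ∘ ![X 0, X 1, X 2] : Fin 3 → A) ![d + 1, 1, 1]) ((d - 1) * p) ((d + 1) * d * D)
  have e1 : (d - 1) * p * ((d + 1) * d * D) = (D * (d - 1)) * ((d + 1) * d * p) := by ring
  rw [e1] at hle
  exact hle h

include hact hC h0 h1 h2 in
/-- Cover element `i` is `τ`-fixed. -/
theorem lines_cover_P_fixed [NeZero p] [CharP A p] (hp1 : p ≠ 1) (D : ℕ) (i : Fin d) :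
    τ ((∏ m ∈ Finset.univ.erase i, ∏ j : ZMod p, (e.symm (C (a m) * X 1 + C (b m) * X 2) + (j.val : A) * e.symm (C (a m + b m) * X 0))) ^ ((d + 1) * d * D)) =
      (∏ m ∈ Finset.univ.erase i, ∏ j : ZMod p, (e.symm (C (a m) * X 1 + C (b m) * X 2) + (j.val : A) * e.symm (C (a m + b m) * X 0))) ^ ((d + 1) * d * D) := by
  rw [map_pow, map_prod]
  simp_rw [lines_norm_fixed σ hC h0 h1 h2 a b e τ hact hp1]

/-- `ℓ̂_m = â_m u₁′ + b̂_m u₂′` in `R^w`: the lifted line. -/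
theorem lines_Lhat_eq (m : Fin d) :
    (⟨_, C_mul_T_mem_cobordantAlgebra _ _ (lines_L_mem (d := d) e (a m) (b m))⟩ : ↥(cobordantAlgebra (e.symm ∘ ![X 0, X 1, X 2] : Fin 3 → A) ![d + 1, 1, 1])) =
      algebraMap A _ (e.symm (C (a m))) * cobordantAlgebra.u' (e.symm ∘ ![X 0, X 1, X 2] : Fin 3 → A) ![d + 1, 1, 1] 1 +
        algebraMap A _ (e.symm (C (b m))) * cobordantAlgebra.u' (e.symm ∘ ![X 0, X 1, X 2] : Fin 3 → A) ![d + 1, 1, 1] 2 := by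
  refine Subtype.ext ?_
  rw [AddMemClass.coe_add, MulMemClass.coe_mul, MulMemClass.coe_mul, cobordantAlgebra.coe_algebraMap, cobordantAlgebra.coe_algebraMap,
    cobordantAlgebra.coe_u', cobordantAlgebra.coe_u']
  change LaurentPolynomial.C (e.symm (C (a m) * X 1 + C (b m) * X 2)) * LaurentPolynomial.T ((1 : ℕ) : ℤ) =
    LaurentPolynomial.C (e.symm (C (a m))) * (LaurentPolynomial.C (e.symm (X 1)) * LaurentPolynomial.T ((1 : ℕ) : ℤ)) +
      LaurentPolynomial.C (e.symm (C (b m))) * (LaurentPolynomial.C (e.symm (X 2)) * LaurentPolynomial.T ((1 : ℕ) : ℤ))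
  simp only [map_add, map_mul]
  ring

/-- `N_m·T^p = ∏_j (ℓ̂_m + j·ĉ_m·(u₀′ s^d))` in `A[T;T⁻¹]`. -/
theorem lines_norm_T [NeZero p] (m : Fin d) :
    LaurentPolynomial.C (∏ j : ZMod p, (e.symm (C (a m) * X 1 + C (b m) * X 2) + (j.val : A) * e.symm (C (a m + b m) * X 0))) * LaurentPolynomial.T (p : ℤ) =
      ∏ j : ZMod p, (LaurentPolynomial.C (e.symm (C (a m) * X 1 + C (b m) * X 2)) * LaurentPolynomial.T 1 +
        (j.val : A[T;T⁻¹]) * (LaurentPolynomial.C (e.symm (C (a m + b m))) *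
          (LaurentPolynomial.C (e.symm (X 0)) * LaurentPolynomial.T ((d + 1 : ℕ) : ℤ) * LaurentPolynomial.T (-(d : ℤ))))) := by
  have hfac : ∀ j : ZMod p, LaurentPolynomial.C (e.symm (C (a m) * X 1 + C (b m) * X 2)) * LaurentPolynomial.T 1 +
      (j.val : A[T;T⁻¹]) * (LaurentPolynomial.C (e.symm (C (a m + b m))) *
        (LaurentPolynomial.C (e.symm (X 0)) * LaurentPolynomial.T ((d + 1 : ℕ) : ℤ) * LaurentPolynomial.T (-(d : ℤ)))) =
      LaurentPolynomial.C (e.symm (C (a m) * X 1 + C (b m) * X 2) + (j.val : A) * e.symm (C (a m + b m) * X 0)) * LaurentPolynomial.T 1 := by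
    intro j
    rw [mul_assoc (LaurentPolynomial.C (e.symm (X 0))), ← LaurentPolynomial.T_add]
    have e1 : ((d + 1 : ℕ) : ℤ) + -(d : ℤ) = 1 := by push_cast; ring
    rw [e1, map_add (LaurentPolynomial.C), map_mul LaurentPolynomial.C, map_natCast, map_mul e.symm (C (a m + b m)) (X 0), map_mul LaurentPolynomial.C]
    ring
  simp_rw [hfac]
  rw [Finset.prod_mul_distrib, ← map_prod, Finset.prod_const, Finset.card_univ, ZMod.card, LaurentPolynomial.T_pow, mul_one]

/-! ## `hrad` for the product cover -/

/-- ★ **`hrad` FOR THE PRODUCT COVER of the line-arrangement root** (`d ≥ 2`, pairwise non-proportional lines): with `c₀ = x₀^{d·n}T^{dbar}`,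
`c_{i+1} = ((∏_{m≠i} N_m)^E)T^{dbar}`, `dbar = E·(d−1)·p`: `u₀′, u₁′, u₂′ ∈ √(c)`. [OURS · L1 W4.5c · R3 product cover] -/
theorem lines_hrad [NeZero p] (hd : 2 ≤ d) (hprop : ∀ i j : Fin d, i ≠ j → a i * b j ≠ a j * b i) (n E dbar : ℕ) (hE : 0 < E)
    (hdbar : (dbar : ℤ) = (E : ℤ) * ((d - 1 : ℕ) : ℤ) * (p : ℤ))
    (c : Fin (d + 1) → ↥(cobordantAlgebra (e.symm ∘ ![X 0, X 1, X 2] : Fin 3 → A) ![d + 1, 1, 1]))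
    (hc₀ : (c 0 : A[T;T⁻¹]) = LaurentPolynomial.C (e.symm (X 0) ^ (d * n)) * LaurentPolynomial.T ((((d + 1) * (d * n)) : ℕ) : ℤ))
    (hcS : ∀ i : Fin d, (c i.succ : A[T;T⁻¹]) = LaurentPolynomial.C ((∏ m ∈ Finset.univ.erase i,
      ∏ j : ZMod p, (e.symm (C (a m) * X 1 + C (b m) * X 2) + (j.val : A) * e.symm (C (a m + b m) * X 0))) ^ E) * LaurentPolynomial.T (dbar : ℤ))
    (l : Fin 3) : cobordantAlgebra.u' (e.symm ∘ ![X 0, X 1, X 2] : Fin 3 → A) ![d + 1, 1, 1] l ∈ (Ideal.span (Set.range c)).radical := by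
  classical
  have _ := hE
  have hu0coe : ((cobordantAlgebra.u' (e.symm ∘ ![X 0, X 1, X 2] : Fin 3 → A) ![d + 1, 1, 1] 0 : ↥(cobordantAlgebra (e.symm ∘ ![X 0, X 1, X 2] : Fin 3 → A) ![d + 1, 1, 1])) : A[T;T⁻¹]) = LaurentPolynomial.C (e.symm (X 0)) * LaurentPolynomial.T ((d + 1 : ℕ) : ℤ) := by
    rw [cobordantAlgebra.coe_u']; rfl
  have hX0 : cobordantAlgebra.u' (e.symm ∘ ![X 0, X 1, X 2] : Fin 3 → A) ![d + 1, 1, 1] 0 ^ (d * n) = c 0 := by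
    refine Subtype.ext ?_
    rw [SubmonoidClass.coe_pow, hu0coe, hc₀, mul_pow, ← map_pow, LaurentPolynomial.T_pow]
    congr 2
    push_cast
    ring
  have hX0rad : cobordantAlgebra.u' (e.symm ∘ ![X 0, X 1, X 2] : Fin 3 → A) ![d + 1, 1, 1] 0 ∈ (Ideal.span (Set.range c)).radical := ⟨d * n, by rw [hX0]; exact Ideal.subset_span ⟨0, rfl⟩⟩
  obtain ⟨Lh, hLh⟩ : ∃ Lh : Fin d → ↥(cobordantAlgebra (e.symm ∘ ![X 0, X 1, X 2] : Fin 3 → A) ![d + 1, 1, 1]), ∀ m, Lh m = algebraMap A (↥(cobordantAlgebra (e.symm ∘ ![X 0, X 1, X 2] : Fin 3 → A) ![d + 1, 1, 1])) (e.symm (C (a m))) * cobordantAlgebra.u' (e.symm ∘ ![X 0, X 1, X 2] : Fin 3 → A) ![d + 1, 1, 1] 1 + algebraMap A (↥(cobordantAlgebra (e.symm ∘ ![X 0, X 1, X 2] : Fin 3 → A) ![d + 1, 1, 1])) (e.symm (C (b m))) * cobordantAlgebra.u' (e.symm ∘ ![X 0, X 1, X 2] : Fin 3 → A) ![d + 1,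 1, 1] 2 := ⟨_, fun _ => rfl⟩
  have hLhcoe : ∀ m, (Lh m : A[T;T⁻¹]) = LaurentPolynomial.C (e.symm (C (a m) * X 1 + C (b m) * X 2)) * LaurentPolynomial.T ((1 : ℕ) : ℤ) := fun m => by
    rw [hLh, ← lines_Lhat_eq a b e m]
  have hprodE : ∀ i : Fin d, (∏ m ∈ Finset.univ.erase i, ∏ j : ZMod p, (Lh m + algebraMap A (↥(cobordantAlgebra (e.symm ∘ ![X 0, X 1, X 2] : Fin 3 → A) ![d + 1, 1, 1])) ((j.val : A) * e.symm (C (a m + b m))) * (cobordantAlgebra.u' (e.symm ∘ ![X 0, X 1, X 2] : Fin 3 → A) ![d + 1, 1, 1] 0 * cobordantAlgebra.s (e.symm ∘ ![X 0, X 1, X 2] : Fin 3 → A) ![d + 1, 1, 1] ^ d))) ^ E = c i.succ := by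
    intro i
    refine Subtype.ext ?_
    rw [SubmonoidClass.coe_pow, SubmonoidClass.coe_finsetProd, hcS i, map_pow]
    have hm : ∀ m : Fin d, ((∏ j : ZMod p, (Lh m + algebraMap A (↥(cobordantAlgebra (e.symm ∘ ![X 0, X 1, X 2] : Fin 3 → A) ![d + 1, 1, 1])) ((j.val : A) * e.symm (C (a m + b m))) * (cobordantAlgebra.u' (e.symm ∘ ![X 0, X 1, X 2] : Fin 3 → A) ![d + 1, 1, 1] 0 * cobordantAlgebra.s (e.symm ∘ ![X 0, X 1, X 2] : Fin 3 → A) ![d + 1, 1, 1] ^ d)) : ↥(cobordantAlgebra (e.symm ∘ ![X 0, X 1, X 2] : Fin 3 → A) ![d + 1, 1, 1])) : A[T;T⁻¹]) =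
        LaurentPolynomial.C (∏ j : ZMod p, (e.symm (C (a m) * X 1 + C (b m) * X 2) + (j.val : A) * e.symm (C (a m + b m) * X 0))) * LaurentPolynomial.T (p : ℤ) := by
      intro m
      rw [SubmonoidClass.coe_finsetProd, lines_norm_T a b e m]
      refine Finset.prod_congr rfl fun j _ => ?_
      rw [AddMemClass.coe_add, MulMemClass.coe_mul, MulMemClass.coe_mul, hLhcoe, hu0coe, cobordantAlgebra.coe_s_pow, cobordantAlgebra.coe_algebraMap, map_mul, map_natCast]
      push_cast
      ring
    simp_rw [hm]
    rw [Finset.prod_mul_distrib, ← map_prod, Finset.prod_const, Finset.card_erase_of_mem (Finset.mem_univ i), Finset.card_univ, Fintype.card_fin,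
      LaurentPolynomial.T_pow, mul_pow, ← map_pow, LaurentPolynomial.T_pow, hdbar]
    congr 2
    ring
  rw [Ideal.radical_eq_sInf, Submodule.mem_sInf]
  rintro J ⟨hIJ, hJprime⟩
  have hU0J : cobordantAlgebra.u' (e.symm ∘ ![X 0, X 1, X 2] : Fin 3 → A) ![d + 1, 1, 1] 0 ∈ J := hJprime.radical_le_iff.mpr hIJ hX0rad
  have hB : cobordantAlgebra.u' (e.symm ∘ ![X 0, X 1, X 2] : Fin 3 → A) ![d + 1, 1, 1] 0 * cobordantAlgebra.s (e.symm ∘ ![X 0, X 1, X 2] : Fin 3 → A) ![d + 1, 1, 1] ^ d ∈ J := Ideal.mul_mem_right _ J hU0J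
  have hstep : ∀ i : Fin d, ∃ m, m ≠ i ∧ Lh m ∈ J := by
    intro i
    have hci : c i.succ ∈ J := hIJ (Ideal.subset_span ⟨i.succ, rfl⟩)
    rw [← hprodE i] at hci
    have hprod := hJprime.mem_of_pow_mem _ hci
    obtain ⟨m, hm, hmJ⟩ := (Ideal.IsPrime.prod_mem_iff (hp := hJprime)).mp hprod
    obtain ⟨j, -, hj⟩ := (Ideal.IsPrime.prod_mem_iff (hp := hJprime)).mp hmJ
    refine ⟨m, Finset.ne_of_mem_erase hm, ?_⟩
    have h2 : algebraMap A (↥(cobordantAlgebra (e.symm ∘ ![X 0, X 1, X 2] : Fin 3 → A) ![d + 1, 1, 1])) ((j.val : A) * e.symm (C (a m + b m))) * (cobordantAlgebra.u' (e.symm ∘ ![X 0, X 1, X 2] : Fin 3 → A) ![d + 1, 1, 1] 0 * cobordantAlgebra.s (e.symm ∘ ![X 0, X 1, X 2] : Fin 3 → A) ![d + 1, 1, 1] ^ d) ∈ J := Ideal.mul_mem_left J _ hB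
    have := Submodule.sub_mem J hj h2
    rwa [add_sub_cancel_right] at this
  have hd0 : 0 < d := by omega
  obtain ⟨m₁, -, hm₁⟩ := hstep ⟨0, hd0⟩
  obtain ⟨m₂, hne, hm₂⟩ := hstep m₁
  have hdet : a m₂ * b m₁ - a m₁ * b m₂ ≠ 0 := sub_ne_zero.mpr (hprop m₂ m₁ hne)
  have hunit : IsUnit (algebraMap A (↥(cobordantAlgebra (e.symm ∘ ![X 0, X 1, X 2] : Fin 3 → A) ![d + 1, 1, 1])) (e.symm (C (a m₂ * b m₁ - a m₁ * b m₂)))) := by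
    refine IsUnit.of_mul_eq_one (algebraMap A (↥(cobordantAlgebra (e.symm ∘ ![X 0, X 1, X 2] : Fin 3 → A) ![d + 1, 1, 1])) (e.symm (C (a m₂ * b m₁ - a m₁ * b m₂)⁻¹))) ?_
    rw [← map_mul, ← map_mul, ← map_mul, mul_inv_cancel₀ hdet, map_one, map_one, map_one]
  have hDexp : algebraMap A (↥(cobordantAlgebra (e.symm ∘ ![X 0, X 1, X 2] : Fin 3 → A) ![d + 1, 1, 1])) (e.symm (C (a m₂ * b m₁ - a m₁ * b m₂))) =
      algebraMap A (↥(cobordantAlgebra (e.symm ∘ ![X 0, X 1, X 2] : Fin 3 → A) ![d + 1, 1, 1])) (e.symm (C (a m₂))) * algebraMap A (↥(cobordantAlgebra (e.symm ∘ ![X 0, X 1, X 2] : Fin 3 → A) ![d + 1, 1, 1])) (e.symm (C (b m₁))) - algebraMap A (↥(cobordantAlgebra (e.symm ∘ ![X 0, X 1, X 2] : Fin 3 → A) ![d + 1, 1, 1])) (e.symm (C (a m₁))) * algebraMap A (↥(cobordantAlgebra (e.symm ∘ ![X 0, X 1, X 2] : Fin 3 → A) ![d + 1, 1, 1])) (e.symm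 (C (b m₂))) := by
    simp only [map_sub, map_mul]
  have hU1 : algebraMap A (↥(cobordantAlgebra (e.symm ∘ ![X 0, X 1, X 2] : Fin 3 → A) ![d + 1, 1, 1])) (e.symm (C (a m₂ * b m₁ - a m₁ * b m₂))) * cobordantAlgebra.u' (e.symm ∘ ![X 0, X 1, X 2] : Fin 3 → A) ![d + 1, 1, 1] 1 = algebraMap A (↥(cobordantAlgebra (e.symm ∘ ![X 0, X 1, X 2] : Fin 3 → A) ![d + 1, 1, 1])) (e.symm (C (b m₁))) * Lh m₂ - algebraMap A (↥(cobordantAlgebra (e.symm ∘ ![X 0, X 1, X 2] : Fin 3 → A) ![d + 1, 1, 1])) (e.symm (C (b m₂))) * Lh m₁ := by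
    rw [hDexp, hLh m₁, hLh m₂]; ring
  have hU2 : algebraMap A (↥(cobordantAlgebra (e.symm ∘ ![X 0, X 1, X 2] : Fin 3 → A) ![d + 1, 1, 1])) (e.symm (C (a m₂ * b m₁ - a m₁ * b m₂))) * cobordantAlgebra.u' (e.symm ∘ ![X 0, X 1, X 2] : Fin 3 → A) ![d + 1, 1, 1] 2 = algebraMap A (↥(cobordantAlgebra (e.symm ∘ ![X 0, X 1, X 2] : Fin 3 → A) ![d + 1, 1, 1])) (e.symm (C (a m₂))) * Lh m₁ - algebraMap A (↥(cobordantAlgebra (e.symm ∘ ![X 0, X 1, X 2] : Fin 3 → A) ![d + 1, 1, 1])) (e.symm (C (a m₁))) * Lh m₂ := by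
    rw [hDexp, hLh m₁, hLh m₂]; ring
  have hU1J : cobordantAlgebra.u' (e.symm ∘ ![X 0, X 1, X 2] : Fin 3 → A) ![d + 1, 1, 1] 1 ∈ J := by
    have h : algebraMap A (↥(cobordantAlgebra (e.symm ∘ ![X 0, X 1, X 2] : Fin 3 → A) ![d + 1, 1, 1])) (e.symm (C (a m₂ * b m₁ - a m₁ * b m₂))) * cobordantAlgebra.u' (e.symm ∘ ![X 0, X 1, X 2] : Fin 3 → A) ![d + 1, 1, 1] 1 ∈ J := by
      rw [hU1]; exact Submodule.sub_mem J (Ideal.mul_mem_left J _ hm₂) (Ideal.mul_mem_left J _ hm₁)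
    exact (hJprime.mem_or_mem h).resolve_left fun hDJ => hJprime.ne_top (Ideal.eq_top_of_isUnit_mem J hDJ hunit)
  have hU2J : cobordantAlgebra.u' (e.symm ∘ ![X 0, X 1, X 2] : Fin 3 → A) ![d + 1, 1, 1] 2 ∈ J := by
    have h : algebraMap A (↥(cobordantAlgebra (e.symm ∘ ![X 0, X 1, X 2] : Fin 3 → A) ![d + 1, 1, 1])) (e.symm (C (a m₂ * b m₁ - a m₁ * b m₂))) * cobordantAlgebra.u' (e.symm ∘ ![X 0, X 1, X 2] : Fin 3 → A) ![d + 1, 1, 1] 2 ∈ J := by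
      rw [hU2]; exact Submodule.sub_mem J (Ideal.mul_mem_left J _ hm₁) (Ideal.mul_mem_left J _ hm₂)
    exact (hJprime.mem_or_mem h).resolve_left fun hDJ => hJprime.ne_top (Ideal.eq_top_of_isUnit_mem J hDJ hunit)
  fin_cases l
  · exact hU0J
  · exact hU1J
  · exact hU2J

end Summit.ResolutionOfSingularities.ResolutionOfSingularities.Theorems.WildQuotientResolution.S1.KillCert.Lines

end
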